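import Summits.BirchSwinnertonDyer.BirchSwinnertonDyer.Theorems.GenusKolyvaginAtTwoMinimalTwinBSDTwoOddCutBudgetFrameDoor
import Summits.BirchSwinnertonDyer.BirchSwinnertonDyer.Theorems.GenusKolyvaginAtTwoMinimalTwinBSDTwoGenusBudgetFrobenius
import Literature.NumberTheory.EllipticCurves.TwistFamilySelmerGroupCardInvarianceProofs
import HarnessLib

/-!
# Route `GenusKolyvaginAtTwo`, crux U₂ `MinimalTwinBSDTwo` (stmt-BirchSwinnertonDyer-22985), LINE 23 «twin_swap» — NVFROB: THE FRAME LEAF WITH NO MODEL,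
# NO HEEGNER OBJECT AND NO TAMAGAWA NUMBER IN ITS ANALYTIC PART — U₂ on the odd habitat cut ⟸ WALL row 1 + PRINT + AU + Čes + Q2 + NVFROB + WITNESS_{dc,≥2}

Seat `bsd-line-gk2-p2` g33 (PROVER seat 2/3, cell `bsd-f1-sign2`, LINE 23 holder), `--supports stmt-BirchSwinnertonDyer-22985 --as helper`.
THEOREMS ONLY (no definition, no named fact, no `sorry`).  BSD is NOT proved by any of this; U₂ is NOT proved; nothing is closed.

WHAT.  NVDOOR (p818043) asked for «a globally minimal twin model `Wd` inside the genus budget» and read the door on `Wd`.  By the genus budget in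
Frobenius terms (p818162, `GenusBudget.exists_budgetTwinModel_of_frobenius`) and the model-invariance of `#Sel₂` (`natCard_selmerGroup_smul`), the leaf
can be stated on `W`, `d_K` and the Frobenius classes of the prime factors of `d_K` ALONE — NVFROB, per `W` on the cut:
«(4 ∣ N_W → ∃ odd-`c` datum) ∧ ∃ K imaginary quadratic (`d_K` odd `≠ −3`, Heegner) with `L(W^{(d_K)},1) ≠ 0`, NO prime factor `q` of `d_K` with
`(Δ/q) = 1 ∧ a_q(W)` even, at most `𝟙[Δ_W < 0]` prime factors with `(Δ/q) = −1`, and (`#Sel₂(W^{(d_K)}) ≠ 1` ∨ [door open] `P(1) ∉ 2W(K[1])` for every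
odd datum and conductor-`1` Heegner datum)».
* §1 `budgetFrameDoor_of_frobeniusFrameDoor` — per curve: NVFROB data ⟹ NVDOOR data.
* §2 ★ `minimalTwinBSDTwo_onOddCut_of_wall_of_frobeniusFrameDoorSupply_of_witnessSupply_of_facts` — **U₂|cut ⟸ WALL row 1 + PRINT + AU + Čes + Q2 +
  NVFROB-supply + WITNESS_{dc,≥2}-supply** (p818043 §2 fed by §1).

HONEST FRAMING.  CONDITIONAL on the displayed hypotheses; NVFROB and WITNESS_{dc,≥2} are OPEN (research: twist non-vanishing inside a Chebotarev class +
Kolyvagin–Zhang `2`-primitivity at door-open frames; Kolyvagin's conjecture at `2` at door-closed frames of depth `≥ 2`); nothing beyond print is claimed;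
BSD is NOT proved.

References: [Kramer1981] Prop. 3; [Kolyvagin1989Izv] Thm. A, B_l; [GrossZagier1986] V.§2; [AbbesUllmo1996] Thm. A; [Cesnavicius2018] Thm. 1.2.
-/

set_option autoImplicit false
set_option linter.dupNamespace false -- `Summit.<P>.<Sub>` repeats `BirchSwinnertonDyer` (D-0017)

noncomputable section

open scoped Classical NumberField

namespace Summit.BirchSwinnertonDyer.BirchSwinnertonDyer.Theorems.GenusExact.TwinSwap.TwinAnnihilation

open Literature.NumberTheory.EllipticCurves Literature.NumberTheory.GaloisRepresentations WeierstrassCurve NumberField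
  IsDedekindDomain Field AddSubgroup Literature.NumberTheory.EllipticCurves.ModularForms
open Summit.BirchSwinnertonDyer.Rank1Residual
open Summit.BirchSwinnertonDyer.BirchSwinnertonDyer.Theses.GenusKolyvaginAtTwo (KolyvaginRelationAtTwo)
open Summit.BirchSwinnertonDyer.BirchSwinnertonDyer.Theorems.GenusExact.TwinSwap.GenusBudget (exists_budgetTwinModel_of_frobenius)

/-! ## §1 NVFROB data ⟹ NVDOOR data, per curve and frame -/

/-- **The Frobenius-form frame carries NVDOOR's twin model and door.**  On the odd habitat cut (`C(W)` odd), at an odd Heegner frame `K` whose ramified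
primes satisfy the Frobenius conditions (no totally split prime of `ℚ(W[2])`, at most `𝟙[Δ_W < 0]` transposition primes), the twist has a globally
minimal model `Wd` inside the genus budget (p818162), and the door read on `W^{(d_K)}` is the door read on `Wd` (`#Sel₂` is model-invariant,
`natCard_selmerGroup_smul`).  BSD is NOT proved. [cite: Kramer1981, Prop. 3] -/
theorem budgetFrameDoor_of_frobeniusFrameDoor
    (W : WeierstrassCurve ℚ) [W.IsElliptic] [W.IsGloballyMinimal] [NeZero (W.conductorNorm ℤ)] (hT : Odd W.tamagawaProduct)
    (K : Type) [Field K] [NumberField K] (hK : IsImaginaryQuadratic K) (hodd : Odd (NumberField.discr K))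
    (hH : SatisfiesHeegnerHypothesis (W.conductorNorm ℤ) K)
    (hno3 : ∀ q ∈ (NumberField.discr K).natAbs.primeFactors, ¬ (jacobiSym W.Δ.num q = 1 ∧ Even (W.frobeniusTrace q)))
    (hcount : ((NumberField.discr K).natAbs.primeFactors.filter (fun q ↦ jacobiSym W.Δ.num q = -1)).card ≤ if W.Δ < 0 then 1 else 0)
    [(W.quadraticTwist (NumberField.discr K : ℚ)).IsElliptic]
    (hdoor : Nat.card ((W.quadraticTwist (NumberField.discr K : ℚ)).selmerGroup 2) ≠ 1 ∨
      ∀ (Dt : ModularParametrizationData W (W.conductorNorm ℤ)), Odd Dt.c → ∀ (β : ℤ) (ι : K →+* ℂ) (d₁ : KolyvaginHeegnerData Dt β ι 1),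
        ¬ ∃ Q : (W.baseChange (ringClassField K ι 1)).toAffine.Point, (2 : ℤ) • Q = d₁.derivedPoint) :
    ∃ (Wd : WeierstrassCurve ℚ) (_ : Wd.IsElliptic) (_ : Wd.IsGloballyMinimal),
      (∃ C : VariableChange ℚ, C • W.quadraticTwist (NumberField.discr K : ℚ) = Wd) ∧
        ((W.Δ < 0 ∧ padicValNat 2 Wd.tamagawaProduct ≤ 1) ∨ padicValNat 2 Wd.tamagawaProduct = 0) ∧
        (Nat.card (Wd.selmerGroup 2) ≠ 1 ∨
          ∀ (Dt : ModularParametrizationData W (W.conductorNorm ℤ)), Odd Dt.c → ∀ (β : ℤ) (ι : K →+* ℂ) (d₁ : KolyvaginHeegnerData Dt β ι 1),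
            ¬ ∃ Q : (W.baseChange (ringClassField K ι 1)).toAffine.Point, (2 : ℤ) • Q = d₁.derivedPoint) := by
  obtain ⟨Wd, iE, iM, ⟨Cd, hCd⟩, hbudget⟩ := exists_budgetTwinModel_of_frobenius W K hK hodd hH hT hno3 hcount
  refine ⟨Wd, iE, iM, ⟨Cd, hCd⟩, hbudget, ?_⟩
  rcases hdoor with hdc | hprim
  · left
    have h := natCard_selmerGroup_smul (W.quadraticTwist (NumberField.discr K : ℚ)) Cd (n := 2) two_ne_zero
    simp only [Nat.cast_ofNat] at h
    rw [← hCd, h]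
    exact hdc
  · exact Or.inr hprim

/-! ## §2 U₂ on the cut from WALL row 1 + PRINT + AU + Čes + Q2 + NVFROB + WITNESS_{dc,≥2} -/

/-- ★ **U₂ ON THE WHOLE ODD HABITAT CUT ⟸ WALL row 1 + PRINT + Abbes–Ullmo + Česnavičius + Q2 + NVFROB-supply + WITNESS_{dc,≥2}-supply** — the census
form of LINE 23's on-cut branch whose frame leaf names no model, no Heegner object and no Tamagawa number: NVFROB-supply (`hNVF`): per `W` on the cut,
«(4 ∣ N_W → ∃ odd datum) ∧ ∃ K imaginary quadratic Heegner (d_K odd ≠ −3) with L(W^{(d_K)},1) ≠ 0, no prime factor q of d_K with (Δ/q) = 1 ∧ a_q even,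
at most 𝟙[Δ_W < 0] prime factors with (Δ/q) = −1, and (#Sel₂(W^{(d_K)}) ≠ 1 ∨ ∀ odd Dt β ι d₁, P(1) ∉ 2W(K[1]))»; WITNESS-supply as in p818043.  Both
OPEN; CONDITIONAL; closes nothing; BSD is NOT proved. [cite: Kramer1981, Prop. 3] [cite: Kolyvagin1989Izv, Thm. A, Thm. B_l] [cite: GrossZagier1986, V.§2 (2.2)]
[cite: AbbesUllmo1996, Thm. A] [cite: Cesnavicius2018, Thm. 1.2] -/
theorem minimalTwinBSDTwo_onOddCut_of_wall_of_frobeniusFrameDoorSupply_of_witnessSupply_of_facts (hQ2 : KolyvaginRelationAtTwo)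
    (hGZ : ∀ (N : ℕ) [NeZero N] (W : WeierstrassCurve ℚ) (K : Type) [Field K] [NumberField K], gross_zagier N W K)
    (hGZK : rank_eq_analyticRank_of_analyticRank_le_one) (hmod : hasEntireLFunction_rat)
    (hMilneC : Milne1972.bsdQuotient_baseChange_quadratic_anyModel) (hMP : nonempty_modularParametrizationData)
    (hAU : abbesUllmo_not_dvd_maninConstant_of_not_dvd_level) (hCes : cesnavicius_not_two_dvd_maninConstant_of_two_dvd_level)
    (hS1 : ∀ (W : WeierstrassCurve ℚ) [W.IsElliptic] [W.IsGloballyMinimal], ¬ W.HasCM → W.analyticRank = 0 → BSDp W 2)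
    (hNVF : ∀ (W : WeierstrassCurve ℚ) [W.IsElliptic] [W.IsGloballyMinimal] [NeZero (W.conductorNorm ℤ)],
      ¬ W.HasCM → W.analyticRank = 1 → Nat.card (W.selmerGroup 2) = 2 → Odd W.tamagawaProduct →
      (∀ n : ℕ, 0 < n → W.HasSurjectiveModNGaloisRep ((2 : ℤ) ^ n)) →
      (∃ v : HeightOneSpectrum (𝓞 ℚ), ((2 : ℕ) : 𝓞 ℚ) ∉ v.asIdeal ∧ ((W.conductorNorm ℤ : ℕ) : 𝓞 ℚ) ∈ v.asIdeal ∧ W.HasMultiplicativeReductionAt v) →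
      (4 ∣ W.conductorNorm ℤ → ∃ Dt : ModularParametrizationData W (W.conductorNorm ℤ), Odd Dt.c) ∧
      ∃ (K : Type) (_ : Field K) (_ : NumberField K), IsImaginaryQuadratic K ∧ Odd (NumberField.discr K) ∧ NumberField.discr K ≠ -3 ∧
        SatisfiesHeegnerHypothesis (W.conductorNorm ℤ) K ∧ (W.quadraticTwist (NumberField.discr K : ℚ)).entireLFunction 1 ≠ 0 ∧
        (∀ q ∈ (NumberField.discr K).natAbs.primeFactors, ¬ (jacobiSym W.Δ.num q = 1 ∧ Even (W.frobeniusTrace q))) ∧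
        ((NumberField.discr K).natAbs.primeFactors.filter (fun q ↦ jacobiSym W.Δ.num q = -1)).card ≤ (if W.Δ < 0 then 1 else 0) ∧
        ∃ (_ : (W.quadraticTwist (NumberField.discr K : ℚ)).IsElliptic),
          (Nat.card ((W.quadraticTwist (NumberField.discr K : ℚ)).selmerGroup 2) ≠ 1 ∨
            ∀ (Dt : ModularParametrizationData W (W.conductorNorm ℤ)), Odd Dt.c → ∀ (β : ℤ) (ι : K →+* ℂ) (d₁ : KolyvaginHeegnerData Dt β ι 1),
              ¬ ∃ Q : (W.baseChange (ringClassField K ι 1)).toAffine.Point, (2 : ℤ) • Q = d₁.derivedPoint))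
    (hWit : ∀ (W : WeierstrassCurve ℚ) [W.IsElliptic] [W.IsGloballyMinimal] [NeZero (W.conductorNorm ℤ)],
      ¬ W.HasCM → W.analyticRank = 1 → Nat.card (W.selmerGroup 2) = 2 → Odd W.tamagawaProduct →
      (∀ n : ℕ, 0 < n → W.HasSurjectiveModNGaloisRep ((2 : ℤ) ^ n)) →
      (∃ v : HeightOneSpectrum (𝓞 ℚ), ((2 : ℕ) : 𝓞 ℚ) ∉ v.asIdeal ∧ ((W.conductorNorm ℤ : ℕ) : 𝓞 ℚ) ∈ v.asIdeal ∧ W.HasMultiplicativeReductionAt v) →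
      ∀ (K : Type) [Field K] [NumberField K], IsImaginaryQuadratic K → Odd (NumberField.discr K) → NumberField.discr K ≠ -3 →
        SatisfiesHeegnerHypothesis (W.conductorNorm ℤ) K →
      ∀ (Dt : ModularParametrizationData W (W.conductorNorm ℤ)), Odd Dt.c →
      ∀ (β : ℤ) (ι : K →+* ℂ) (d₁ : KolyvaginHeegnerData Dt β ι 1), ¬ IsOfFinAddOrder d₁.derivedPoint →
      ∀ (M₀ : ℕ), (∃ Q : (W.baseChange (ringClassField K ι 1)).toAffine.Point, ((2 ^ M₀ : ℕ) : ℤ) • Q = d₁.derivedPoint) →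
        (¬ ∃ Q : (W.baseChange (ringClassField K ι 1)).toAffine.Point, ((2 ^ (M₀ + 1) : ℕ) : ℤ) • Q = d₁.derivedPoint) → 2 ≤ M₀ →
      ∀ (Wd : WeierstrassCurve ℚ) [Wd.IsElliptic] [Wd.IsGloballyMinimal],
        (∃ C : VariableChange ℚ, C • W.quadraticTwist (NumberField.discr K : ℚ) = Wd) →
        ((W.Δ < 0 ∧ padicValNat 2 Wd.tamagawaProduct ≤ 1) ∨ padicValNat 2 Wd.tamagawaProduct = 0) → Nat.card (Wd.selmerGroup 2) ≠ 1 →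
        ∃ (n : ℕ) (d : KolyvaginHeegnerData Dt β ι n), Squarefree n ∧
          (∀ ℓ ∈ n.primeFactors, Zhang2014.IsKolyvaginPrime (W.conductorNorm ℤ) W K 2 ℓ ∧ 2 ≤ Zhang2014.kolyvaginIndex W 2 ℓ ∧
            ∃ (v : HeightOneSpectrum (𝓞 ℚ)) (𝔓 : Ideal (absIntegers (𝓞 ℚ) ℚ)) (h : absoluteGaloisGroup ℚ),
              ((ℓ : ℕ) : 𝓞 ℚ) ∈ v.asIdeal ∧ 𝔓 ∈ v.primesAbove ∧ IsArithFrobAt (𝓞 ℚ) h 𝔓 ∧ ∃ u : W.geomTorsion ((2 : ℕ) : ℤ), h • u ≠ u) ∧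
          ¬ ∃ Q : (W.baseChange (ringClassField K ι n)).toAffine.Point, (2 : ℤ) • Q = d.derivedPoint) :
    ∀ (W : WeierstrassCurve ℚ) [W.IsElliptic] [W.IsGloballyMinimal] [NeZero (W.conductorNorm ℤ)],
      ¬ W.HasCM → W.analyticRank = 1 → Nat.card (W.selmerGroup 2) = 2 → Odd W.tamagawaProduct →
      (∀ n : ℕ, 0 < n → W.HasSurjectiveModNGaloisRep ((2 : ℤ) ^ n)) →
      (∃ v : HeightOneSpectrum (𝓞 ℚ), ((2 : ℕ) : 𝓞 ℚ) ∉ v.asIdeal ∧ ((W.conductorNorm ℤ : ℕ) : 𝓞 ℚ) ∈ v.asIdeal ∧ W.HasMultiplicativeReductionAt v) →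
      BSDp W 2 := by
  refine minimalTwinBSDTwo_onOddCut_of_wall_of_budgetFrameDoorSupply_of_witnessSupply_of_facts hQ2 hGZ hGZK hmod hMilneC hMP hAU hCes hS1 ?_ hWit
  intro W _ _ _ hcm hr hSel hT hρ hv
  obtain ⟨h4, K, iF, iN, hK, hodd, h3, hH, hLv, hno3, hcount, iT, hdoor⟩ := hNVF W hcm hr hSel hT hρ hv
  obtain ⟨Wd, iE, iM, hWd, hbudget, hdoorW⟩ := budgetFrameDoor_of_frobeniusFrameDoor W hT K hK hodd hH hno3 hcount hdoor
  exact ⟨h4, K, iF, iN, hK, hodd, h3, hH, hLv, Wd, iE, iM, hWd, hbudget, hdoorW⟩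

end Summit.BirchSwinnertonDyer.BirchSwinnertonDyer.Theorems.GenusExact.TwinSwap.TwinAnnihilation

end
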